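import Summits.QuantumFields.BalabanUV.Beta.GAN24.T2RecursionAffine
import Summits.QuantumFields.BalabanUV.Beta.GAN24.AffineUnroll
import Summits.QuantumFields.BalabanUV.Beta.ChartConjugationReflection
import Summits.QuantumFields.BalabanUV.Beta.VertexReflectionContact

/-!
# `BalabanUV.Beta.GAN24.Lin4Additive` — binder row G-an2-4 / (CONV-C), W-slot, road «W3» (F1): THE LINEAR PART `lin4` OF THE NORMALISED
# T₂ RECURSION IS ADDITIVE AND HOMOGENEOUS ON BOUNDED TABLES, AND PRESERVES BOUNDEDNESS (G-an2-4 FORMAL swarm, leaf-01 lineage, gen 14;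
# part 2 of «W3-L1 T2SPLIT*» — the class on which the discrete Duhamel engine `AffineUnroll` runs)

NOT IN PRINT; OUR BOOKKEEPING.  HONEST FRAMING (cell contract, verbatim): «discharging `BetaPertH` makes Bałaban's UV stability
UNCONDITIONAL — a real constructive-QFT result; it is NOT the continuum limit and NOT the Clay problem.»  HONEST DEPENDENCY (verbatim):
«continuum YM on T⁴ ⇐ BetaPertH ∧ nine spine estimates (0/9 proved); BetaPertH ⇐ (D1) ∧ (D4) ∧ CAP+tail; G-an2-4 gates asym, D1 and
NE2/3/4.»

WHY.  The n-level unrolling of the affine recursion `T♮_{j+1} = 𝒜_j[T♮_j] + b_j` (leaf-04's `T2RecursionAffine.unitS₂_T2Of_succ_affine`,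
`𝒜_j = lin4 (cE₂·Lc^{2(d+1)}) K♮_j Lc`; row owner gan24-p1's SKELETON-W3 v0.2 §1.2 / (F1) `hsplit` of `WSlotT2OfPieces.shape_of_rows`) by the
engine `AffineUnroll.eq_transport_add_sum` needs the maps `𝒜_j` to be ADDITIVE on a class containing the members and the sources.  `lin4` is
built from `tsum`s (`vertex2OfK` = two nested weighted superpositions, `comp` = two kernel compositions), so it is additive exactly where
those series converge.  THE CLASS OF RECORD: tables with UNIFORMLY BOUNDED ENTRIES, `∃ B, ∀ κ u κ′ u′ x z a b, |T κ u κ′ u′ x z a b| ≤ B`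
(every `LocStencil₂` family is in it; no rate, no shape is needed for the algebra).  For a DECAYING packed kernel `K` (rate `δ > 0`):

§1 bounded-entry calculus — `abs_wsum_le`, `abs_vertexOfK_le`, `abs_vertex2OfK_le`, `abs_vsym_le`, slice summabilities
   `summable_slices_decays_bdd` / `summable_slices_bdd_decays`, `bdd_comp_decays_bdd`, `bdd_comp_bdd_decays`, `bdd_mmRead`, and
   **`lin4_bdd`**: `lin4 c K N` maps bounded tables to bounded tables (explicit constant `lin4Bound`-free: stated with `∃`);
§2 additivity — `vertex2OfK_add`, `vsym_add`, **`lin4_add`** (on bounded tables), hence `lin4_sub`;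
§3 homogeneity (unconditional, `tsum_mul_left` only) — `vertex2OfK_smul`, `vsym_smul`, **`lin4_smul`**, and `lin4_eq_smul_sandwich`
   (`lin4 c K N T = (−c) • [the bare sandwich]`) with **`transport_lin4_eq_pow_smul`**: the k-fold transport of the `lin4 c (K j) N` family is
   `(−c)^k •` the transport of the bare sandwiches (SKELETON-W3 (R12-3): every power of `cE₂·Lc^{2(d+1)}` DISPLAYED).
[folklore] kernel algebra over an2's/an4's definitions BY NAME (`vertexOfK`, `vertex2OfK`, `comp`, `mmRead`, leaf-04's `vsym`/`lin4`); tree bricks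
`ChartConjugationReflection.vertexOfK_add`, `StepJetData.comp_add_right`, `VertexReflectionContact.comp_add_left`/`mmRead_add`,
`KernelReflection.comp_smul_left/right`, `SecondOrderUnits.vertexOfK_smul_table`.  Asserts NO bound uniform in `j`, NO shape of Bałaban's
tables; discharges NOTHING of «T2Shape»/«T2SupRate»/(hW, hWall); NOT «W-slot closed», NEVER «G-an2-4 closed»; NOT BetaPertH, NOT continuum, NOT Clay.
-/

noncomputable section

open Finset
open scoped BigOperators
open Literature.MathematicalPhysics.QuantumFieldTheory
open Literature.MathematicalPhysics.QuantumFieldTheory.Balaban1983to89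
open Literature.MathematicalPhysics.QuantumFieldTheory.Balaban1983to89.Beta
open B12Sec2to5 (l1 l1_nonneg)
open ExpKernelCalculus (MKer Decays comp Zl Zl_nonneg tsum_exp_shift tsum_exp_shift' summable_exp_shift summable_exp_shift')
open OneStepResolventKernel (Fib wsum)
open OneStepKernelFamily (colH vertexOfK abs_colH_le)
open SecondOrderResponse (vertex2OfK)
open BalabanStepJetsSucc (mmRead mmRead_inl_inl)
open KernelWard (Bdd)
open StepJetData (comp_add_right)
open Summit.QuantumFields.BalabanUV.Beta.ChartConjugationReflection (vertexOfK_add)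
open Summit.QuantumFields.BalabanUV.Beta.VertexReflectionContact (comp_add_left mmRead_add)
open Summit.QuantumFields.BalabanUV.Beta.SecondOrderUnits (vertexOfK_smul_table)
open Summit.QuantumFields.BalabanUV.Beta.GAN24.ThirdJetKernel (mmRead_smul)
open Summit.QuantumFields.BalabanUV.Beta.GAN24.T2RecursionAffine (vsym lin4 lin4_apply)
open Summit.QuantumFields.BalabanUV.Beta.GAN24.AffineUnroll (transport transport_smul_eq)

namespace Summit.QuantumFields.BalabanUV.Beta.GAN24.Lin4Additive

variable {d : ℕ}

/-! ## §1 Bounded-entry calculus through a decaying kernel -/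

/-- [folklore] A weighted superposition with weights decaying from a point (rate `δ > 0`, constant `C`) of a family of kernels with entries
bounded by `B` has entries bounded by `C·Zl(δ)·B`. -/
theorem abs_wsum_le {w : (Fin (d + 1) → ℤ) → ℝ} {S : (Fin (d + 1) → ℤ) → MKer (d + 1) (Fib d)} {C δ B : ℝ} {p : Fin (d + 1) → ℤ}
    (hw : ∀ u, |w u| ≤ C * Real.exp (-δ * l1 (u - p))) (hδ : 0 < δ) (hS : ∀ u x z a b, |S u x z a b| ≤ B)
    (x z : Fin (d + 1) → ℤ) (a b : Fib d) : |wsum w S x z a b| ≤ C * Zl (d + 1) δ * B := by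
  unfold wsum
  have hmaj := ((summable_exp_shift' hδ p).mul_left C).mul_right B
  have hb := tsum_of_norm_bounded hmaj.hasSum (fun u => by
    rw [Real.norm_eq_abs, abs_mul]
    exact mul_le_mul (hw u) (hS u x z a b) (abs_nonneg _) ((abs_nonneg _).trans (hw u)))
  rw [Real.norm_eq_abs] at hb
  refine hb.trans (le_of_eq ?_)
  rw [tsum_mul_right, tsum_mul_left, tsum_exp_shift']

/-- [folklore] The chain-rule vertex through a decaying `K` of a family with entries bounded by `B` has entries bounded by `(d+1)·C·Zl(δ)·B`. -/
theorem abs_vertexOfK_le {K : MKer (d + 1) (Fib d)} {C δ : ℝ} (hK : Decays K C δ) (hδ : 0 < δ) (N : ℕ)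
    {S : Fin (d + 1) → (Fin (d + 1) → ℤ) → MKer (d + 1) (Fib d)} {B : ℝ} (hS : ∀ κ' u x z a b, |S κ' u x z a b| ≤ B)
    (μ : Fin (d + 1)) (y x z : Fin (d + 1) → ℤ) (a b : Fib d) :
    |vertexOfK K N S μ y x z a b| ≤ ((d + 1 : ℕ) : ℝ) * (C * Zl (d + 1) δ * B) := by
  show |∑ κ' : Fin (d + 1), wsum (colH K N μ y κ') (S κ') x z a b| ≤ _
  calc |∑ κ' : Fin (d + 1), wsum (colH K N μ y κ') (S κ') x z a b|
      ≤ ∑ κ' : Fin (d + 1), |wsum (colH K N μ y κ') (S κ') x z a b| := Finset.abs_sum_le_sum_abs _ _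
    _ ≤ ∑ _κ' : Fin (d + 1), C * Zl (d + 1) δ * B :=
        Finset.sum_le_sum fun κ' _ => abs_wsum_le (fun u => abs_colH_le (N := N) hK μ y κ' u) hδ (hS κ') x z a b
    _ = ((d + 1 : ℕ) : ℝ) * (C * Zl (d + 1) δ * B) := by
        rw [Finset.sum_const, Finset.card_univ, Fintype.card_fin, nsmul_eq_mul]

/-- [folklore] The bi-vertex through a decaying `K` of a bi-table with entries bounded by `B` has bounded entries. -/
theorem abs_vertex2OfK_le {K : MKer (d + 1) (Fib d)} {C δ : ℝ} (hK : Decays K C δ) (hδ : 0 < δ) (N : ℕ)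
    {T : Fin (d + 1) → (Fin (d + 1) → ℤ) → Fin (d + 1) → (Fin (d + 1) → ℤ) → MKer (d + 1) (Fib d)} {B : ℝ}
    (hT : ∀ κ u κ' u' x z a b, |T κ u κ' u' x z a b| ≤ B)
    (μ : Fin (d + 1)) (y : Fin (d + 1) → ℤ) (ν : Fin (d + 1)) (y' x z : Fin (d + 1) → ℤ) (a b : Fib d) :
    |vertex2OfK K N T μ y ν y' x z a b| ≤
      ((d + 1 : ℕ) : ℝ) * (C * Zl (d + 1) δ * (((d + 1 : ℕ) : ℝ) * (C * Zl (d + 1) δ * B))) :=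
  abs_vertexOfK_le hK hδ N (S := fun κ u => vertexOfK K N (T κ u) ν y')
    (fun κ u x z a b => abs_vertexOfK_le hK hδ N (hT κ u) ν y' x z a b) μ y x z a b

/-- [folklore] leaf-04's symmetrised bi-vertex `vsym` of a bounded bi-table has bounded entries (same constant). -/
theorem abs_vsym_le {K : MKer (d + 1) (Fib d)} {C δ : ℝ} (hK : Decays K C δ) (hδ : 0 < δ) (N : ℕ)
    {T : Fin (d + 1) → (Fin (d + 1) → ℤ) → Fin (d + 1) → (Fin (d + 1) → ℤ) → MKer (d + 1) (Fib d)} {B : ℝ}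
    (hT : ∀ κ u κ' u' x z a b, |T κ u κ' u' x z a b| ≤ B)
    (μ : Fin (d + 1)) (y : Fin (d + 1) → ℤ) (ν : Fin (d + 1)) (y' x z : Fin (d + 1) → ℤ) (a b : Fib d) :
    |vsym K N T μ y ν y' x z a b| ≤
      ((d + 1 : ℕ) : ℝ) * (C * Zl (d + 1) δ * (((d + 1 : ℕ) : ℝ) * (C * Zl (d + 1) δ * B))) := by
  have h1 := abs_vertex2OfK_le hK hδ N hT μ y ν y' x z a b
  have h2 := abs_vertex2OfK_le hK hδ N hT ν y' μ y x z a b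
  simp only [vsym, Pi.smul_apply, Pi.add_apply, smul_eq_mul]
  rw [abs_mul, abs_of_pos (by norm_num : (0 : ℝ) < 1 / 2)]
  have h3 := abs_add_le (vertex2OfK K N T μ y ν y' x z a b) (vertex2OfK K N T ν y' μ y x z a b)
  nlinarith

/-- [folklore] Slices `y ↦ Σ_f K x y a f · V y z f b` of a DECAYING `K` against a BOUNDED `V` are summable. -/
theorem summable_slices_decays_bdd {K V : MKer (d + 1) (Fib d)} {C δ B : ℝ} (hK : Decays K C δ) (hδ : 0 < δ) (hV : Bdd V B)
    (x z : Fin (d + 1) → ℤ) (a b : Fib d) : Summable fun y : Fin (d + 1) → ℤ => ∑ f, K x y a f * V y z f b := by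
  refine summable_sum fun f _ => Summable.of_norm_bounded (((summable_exp_shift hδ x).mul_left C).mul_right B) (fun y => ?_)
  rw [Real.norm_eq_abs, abs_mul]
  exact mul_le_mul (hK x y a f) (hV y z f b) (abs_nonneg _) ((abs_nonneg _).trans (hK x y a f))

/-- [folklore] Slices `y ↦ Σ_f V x y a f · K y z f b` of a BOUNDED `V` against a DECAYING `K` are summable. -/
theorem summable_slices_bdd_decays {K V : MKer (d + 1) (Fib d)} {C δ B : ℝ} (hV : Bdd V B) (hK : Decays K C δ) (hδ : 0 < δ)
    (x z : Fin (d + 1) → ℤ) (a b : Fib d) : Summable fun y : Fin (d + 1) → ℤ => ∑ f, V x y a f * K y z f b := by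
  refine summable_sum fun f _ => Summable.of_norm_bounded (((summable_exp_shift' hδ z).mul_left C).mul_left B) (fun y => ?_)
  rw [Real.norm_eq_abs, abs_mul]
  exact mul_le_mul (hV x y a f) (hK y z f b) (abs_nonneg _) ((abs_nonneg _).trans (hV x y a f))

/-- [folklore] `K ∘ V` for a decaying `K` and a bounded `V` is bounded, constant `|F|·C·Zl(δ)·B`. -/
theorem bdd_comp_decays_bdd {K V : MKer (d + 1) (Fib d)} {C δ B : ℝ} (hK : Decays K C δ) (hδ : 0 < δ) (hV : Bdd V B) :
    Bdd (comp K V) ((Fintype.card (Fib d) : ℝ) * (C * Zl (d + 1) δ * B)) := by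
  intro x z a b
  unfold comp
  have hmaj := (((summable_exp_shift hδ x).mul_left C).mul_right B).mul_left (Fintype.card (Fib d) : ℝ)
  have hb := tsum_of_norm_bounded hmaj.hasSum (fun y => by
    rw [Real.norm_eq_abs]
    calc |∑ f, K x y a f * V y z f b| ≤ ∑ f, |K x y a f * V y z f b| := Finset.abs_sum_le_sum_abs _ _
      _ ≤ ∑ _f : Fib d, C * Real.exp (-δ * l1 (x - y)) * B := Finset.sum_le_sum fun f _ => by
          rw [abs_mul]
          exact mul_le_mul (hK x y a f) (hV y z f b) (abs_nonneg _) ((abs_nonneg _).trans (hK x y a f))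
      _ = (Fintype.card (Fib d) : ℝ) * (C * Real.exp (-δ * l1 (x - y)) * B) := by
          rw [Finset.sum_const, Finset.card_univ, nsmul_eq_mul])
  rw [Real.norm_eq_abs] at hb
  refine hb.trans (le_of_eq ?_)
  rw [tsum_mul_left, tsum_mul_right, tsum_mul_left, tsum_exp_shift]

/-- [folklore] `V ∘ K` for a bounded `V` and a decaying `K` is bounded, constant `|F|·B·C·Zl(δ)`. -/
theorem bdd_comp_bdd_decays {K V : MKer (d + 1) (Fib d)} {C δ B : ℝ} (hV : Bdd V B) (hK : Decays K C δ) (hδ : 0 < δ) :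
    Bdd (comp V K) ((Fintype.card (Fib d) : ℝ) * (B * (C * Zl (d + 1) δ))) := by
  intro x z a b
  unfold comp
  have hmaj := (((summable_exp_shift' hδ z).mul_left C).mul_left B).mul_left (Fintype.card (Fib d) : ℝ)
  have hb := tsum_of_norm_bounded hmaj.hasSum (fun y => by
    rw [Real.norm_eq_abs]
    calc |∑ f, V x y a f * K y z f b| ≤ ∑ f, |V x y a f * K y z f b| := Finset.abs_sum_le_sum_abs _ _
      _ ≤ ∑ _f : Fib d, B * (C * Real.exp (-δ * l1 (y - z))) := Finset.sum_le_sum fun f _ => by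
          rw [abs_mul]
          exact mul_le_mul (hV x y a f) (hK y z f b) (abs_nonneg _) ((abs_nonneg _).trans (hV x y a f))
      _ = (Fintype.card (Fib d) : ℝ) * (B * (C * Real.exp (-δ * l1 (y - z)))) := by
          rw [Finset.sum_const, Finset.card_univ, nsmul_eq_mul])
  rw [Real.norm_eq_abs] at hb
  refine hb.trans (le_of_eq ?_)
  rw [tsum_mul_left, tsum_mul_left, tsum_mul_left, tsum_exp_shift']

/-- [folklore] The `mm`-read of a bounded kernel is bounded (same constant; the off-diagonal blocks of `mmRead` are `0`). -/
theorem bdd_mmRead {F : MKer (d + 1) (Fib d)} {B : ℝ} (hF : Bdd F B) (M : ℕ) : Bdd (mmRead M F) B := by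
  have hB : 0 ≤ B := (abs_nonneg _).trans (hF 0 0 (Sum.inl 0) (Sum.inl 0))
  intro x z a b
  rcases a with α | μ <;> rcases b with β | ν
  · rw [mmRead_inl_inl]; exact hF _ _ _ _
  all_goals simp [mmRead, hB]

/-- [folklore] **`lin4` PRESERVES BOUNDEDNESS**: for a decaying `K` (rate `δ > 0`), every scalar `c` and blocking `N`, a bi-table with
uniformly bounded entries is sent by `lin4 c K N` to a bi-table with uniformly bounded entries. -/
theorem lin4_bdd {K : MKer (d + 1) (Fib d)} {C δ : ℝ} (hK : Decays K C δ) (hδ : 0 < δ) (c : ℝ) (N : ℕ)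
    {T : Fin (d + 1) → (Fin (d + 1) → ℤ) → Fin (d + 1) → (Fin (d + 1) → ℤ) → MKer (d + 1) (Fib d)}
    (hT : ∃ B, ∀ κ u κ' u' x z a b, |T κ u κ' u' x z a b| ≤ B) :
    ∃ B', ∀ κ u κ' u' x z a b, |lin4 c K N T κ u κ' u' x z a b| ≤ B' := by
  obtain ⟨B, hB⟩ := hT
  set B₂ : ℝ := ((d + 1 : ℕ) : ℝ) * (C * Zl (d + 1) δ * (((d + 1 : ℕ) : ℝ) * (C * Zl (d + 1) δ * B)))
  set B₃ : ℝ := (Fintype.card (Fib d) : ℝ) * ((Fintype.card (Fib d) : ℝ) * (C * Zl (d + 1) δ * B₂) * (C * Zl (d + 1) δ))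
  refine ⟨|c| * B₃, fun κ u κ' u' x z a b => ?_⟩
  have hV : Bdd (vsym K N T κ u κ' u') B₂ := fun x z a b => abs_vsym_le hK hδ N hB κ u κ' u' x z a b
  have hS : Bdd (mmRead N (comp (comp K (vsym K N T κ u κ' u')) K)) B₃ :=
    bdd_mmRead (bdd_comp_bdd_decays (bdd_comp_decays_bdd hK hδ hV) hK hδ) N
  rw [lin4_apply]
  simp only [Pi.neg_apply, Pi.smul_apply, smul_eq_mul, abs_neg, abs_mul]
  exact mul_le_mul_of_nonneg_left (hS x z a b) (abs_nonneg c)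

/-! ## §2 Additivity on bounded tables -/

/-- [folklore] **THE BI-VERTEX IS ADDITIVE IN ITS TABLE** (decaying `K`, bounded tables): two applications of
`ChartConjugationReflection.vertexOfK_add`, the inner families being bounded by `abs_vertexOfK_le`. -/
theorem vertex2OfK_add {K : MKer (d + 1) (Fib d)} {C δ : ℝ} (hK : Decays K C δ) (hδ : 0 < δ) (N : ℕ)
    {T T' : Fin (d + 1) → (Fin (d + 1) → ℤ) → Fin (d + 1) → (Fin (d + 1) → ℤ) → MKer (d + 1) (Fib d)} {B : ℝ}
    (hT : ∀ κ u κ' u' x z a b, |T κ u κ' u' x z a b| ≤ B) (hT' : ∀ κ u κ' u' x z a b, |T' κ u κ' u' x z a b| ≤ B)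
    (μ : Fin (d + 1)) (y : Fin (d + 1) → ℤ) (ν : Fin (d + 1)) (y' : Fin (d + 1) → ℤ) :
    vertex2OfK K N (T + T') μ y ν y' = vertex2OfK K N T μ y ν y' + vertex2OfK K N T' μ y ν y' := by
  have hC : 0 ≤ C := hK.nonneg (Sum.inl 0)
  have hKex : ∃ δ C : ℝ, 0 < δ ∧ 0 ≤ C ∧ Decays K C δ := ⟨δ, C, hδ, hC, hK⟩
  have hsum : ∀ κ u, vertexOfK K N ((T + T') κ u) ν y' = vertexOfK K N (T κ u) ν y' + vertexOfK K N (T' κ u) ν y' := by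
    intro κ u
    have e : (T + T') κ u = fun κ' u' => T κ u κ' u' + T' κ u κ' u' := rfl
    rw [e]
    exact vertexOfK_add (N := N) hKex (hT κ u) (hT' κ u) ν y'
  have hin : (fun κ u => vertexOfK K N ((T + T') κ u) ν y') =
      fun κ u => (fun κ u => vertexOfK K N (T κ u) ν y') κ u + (fun κ u => vertexOfK K N (T' κ u) ν y') κ u := by
    funext κ u
    exact hsum κ u
  unfold vertex2OfK
  rw [hin]
  exact vertexOfK_add (N := N) hKex (S := fun κ u => vertexOfK K N (T κ u) ν y') (T := fun κ u => vertexOfK K N (T' κ u) ν y')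
    (fun κ u x z a b => abs_vertexOfK_le hK hδ N (hT κ u) ν y' x z a b)
    (fun κ u x z a b => abs_vertexOfK_le hK hδ N (hT' κ u) ν y' x z a b) μ y

/-- [folklore] leaf-04's symmetrised bi-vertex `vsym` is additive in its table (decaying `K`, bounded tables). -/
theorem vsym_add {K : MKer (d + 1) (Fib d)} {C δ : ℝ} (hK : Decays K C δ) (hδ : 0 < δ) (N : ℕ)
    {T T' : Fin (d + 1) → (Fin (d + 1) → ℤ) → Fin (d + 1) → (Fin (d + 1) → ℤ) → MKer (d + 1) (Fib d)} {B : ℝ}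
    (hT : ∀ κ u κ' u' x z a b, |T κ u κ' u' x z a b| ≤ B) (hT' : ∀ κ u κ' u' x z a b, |T' κ u κ' u' x z a b| ≤ B)
    (μ : Fin (d + 1)) (y : Fin (d + 1) → ℤ) (ν : Fin (d + 1)) (y' : Fin (d + 1) → ℤ) :
    vsym K N (T + T') μ y ν y' = vsym K N T μ y ν y' + vsym K N T' μ y ν y' := by
  simp only [vsym]
  rw [vertex2OfK_add hK hδ N hT hT', vertex2OfK_add hK hδ N hT hT', ← smul_add]
  congr 1
  abel

/-- [folklore] **`lin4` IS ADDITIVE ON BOUNDED TABLES** (decaying `K`, rate `δ > 0`): `lin4 c K N (T + T′) = lin4 c K N T + lin4 c K N T′` —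
`vsym_add`, then the two kernel compositions split (`StepJetData.comp_add_right`, `VertexReflectionContact.comp_add_left`; slices summable by
`summable_slices_decays_bdd` / `summable_slices_bdd_decays`), then the pointwise `mmRead_add`. -/
theorem lin4_add {K : MKer (d + 1) (Fib d)} {C δ : ℝ} (hK : Decays K C δ) (hδ : 0 < δ) (c : ℝ) (N : ℕ)
    {T T' : Fin (d + 1) → (Fin (d + 1) → ℤ) → Fin (d + 1) → (Fin (d + 1) → ℤ) → MKer (d + 1) (Fib d)} {B : ℝ}
    (hT : ∀ κ u κ' u' x z a b, |T κ u κ' u' x z a b| ≤ B) (hT' : ∀ κ u κ' u' x z a b, |T' κ u κ' u' x z a b| ≤ B) :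
    lin4 c K N (T + T') = lin4 c K N T + lin4 c K N T' := by
  funext κ u κ' u'
  have hV : Bdd (vsym K N T κ u κ' u') _ := fun x z a b => abs_vsym_le hK hδ N hT κ u κ' u' x z a b
  have hV' : Bdd (vsym K N T' κ u κ' u') _ := fun x z a b => abs_vsym_le hK hδ N hT' κ u κ' u' x z a b
  have h1 : comp K (vsym K N T κ u κ' u' + vsym K N T' κ u κ' u') =
      comp K (vsym K N T κ u κ' u') + comp K (vsym K N T' κ u κ' u') :=
    comp_add_right (summable_slices_decays_bdd hK hδ hV) (summable_slices_decays_bdd hK hδ hV')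
  have h2 : comp (comp K (vsym K N T κ u κ' u') + comp K (vsym K N T' κ u κ' u')) K =
      comp (comp K (vsym K N T κ u κ' u')) K + comp (comp K (vsym K N T' κ u κ' u')) K :=
    comp_add_left (summable_slices_bdd_decays (bdd_comp_decays_bdd hK hδ hV) hK hδ)
      (summable_slices_bdd_decays (bdd_comp_decays_bdd hK hδ hV') hK hδ)
  simp only [Pi.add_apply]
  rw [lin4_apply, lin4_apply, lin4_apply, vsym_add hK hδ N hT hT', h1, h2, mmRead_add, smul_add, neg_add]

/-- [folklore] `lin4` is subtractive on bounded tables. -/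
theorem lin4_sub {K : MKer (d + 1) (Fib d)} {C δ : ℝ} (hK : Decays K C δ) (hδ : 0 < δ) (c : ℝ) (N : ℕ)
    {T T' : Fin (d + 1) → (Fin (d + 1) → ℤ) → Fin (d + 1) → (Fin (d + 1) → ℤ) → MKer (d + 1) (Fib d)} {B : ℝ}
    (hT : ∀ κ u κ' u' x z a b, |T κ u κ' u' x z a b| ≤ B) (hT' : ∀ κ u κ' u' x z a b, |T' κ u κ' u' x z a b| ≤ B) :
    lin4 c K N (T - T') = lin4 c K N T - lin4 c K N T' := by
  have hB : 0 ≤ B := (abs_nonneg _).trans (hT 0 0 0 0 0 0 (Sum.inl 0) (Sum.inl 0))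
  have hd : ∀ κ u κ' u' x z a b, |(T - T') κ u κ' u' x z a b| ≤ B + B := fun κ u κ' u' x z a b => by
    simp only [Pi.sub_apply]
    exact (abs_sub _ _).trans (add_le_add (hT κ u κ' u' x z a b) (hT' κ u κ' u' x z a b))
  have hT'2 : ∀ κ u κ' u' x z a b, |T' κ u κ' u' x z a b| ≤ B + B := fun κ u κ' u' x z a b =>
    (hT' κ u κ' u' x z a b).trans (by linarith)
  have h := lin4_add hK hδ c N hd hT'2
  rw [sub_add_cancel] at h
  rw [h, add_sub_cancel_right]

/-! ## §3 Homogeneity (unconditional) and the displayed powers of the scalar -/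

/-- [folklore] The bi-vertex is homogeneous in its table (no summability needed: `tsum_mul_left`). -/
theorem vertex2OfK_smul (K : MKer (d + 1) (Fib d)) (N : ℕ) (r : ℝ)
    (T : Fin (d + 1) → (Fin (d + 1) → ℤ) → Fin (d + 1) → (Fin (d + 1) → ℤ) → MKer (d + 1) (Fib d))
    (μ : Fin (d + 1)) (y : Fin (d + 1) → ℤ) (ν : Fin (d + 1)) (y' : Fin (d + 1) → ℤ) :
    vertex2OfK K N (r • T) μ y ν y' = r • vertex2OfK K N T μ y ν y' := by
  have hin : (fun κ u => vertexOfK K N ((r • T) κ u) ν y') = r • fun κ u => vertexOfK K N (T κ u) ν y' := by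
    funext κ u
    exact vertexOfK_smul_table K N r (T κ u) ν y'
  unfold vertex2OfK
  rw [hin, vertexOfK_smul_table]

/-- [folklore] `vsym` is homogeneous in its table. -/
theorem vsym_smul (K : MKer (d + 1) (Fib d)) (N : ℕ) (r : ℝ)
    (T : Fin (d + 1) → (Fin (d + 1) → ℤ) → Fin (d + 1) → (Fin (d + 1) → ℤ) → MKer (d + 1) (Fib d))
    (μ : Fin (d + 1)) (y : Fin (d + 1) → ℤ) (ν : Fin (d + 1)) (y' : Fin (d + 1) → ℤ) :
    vsym K N (r • T) μ y ν y' = r • vsym K N T μ y ν y' := by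
  simp only [vsym]
  rw [vertex2OfK_smul, vertex2OfK_smul, ← smul_add, smul_smul, smul_smul, mul_comm]

/-- [folklore] **`lin4` IS HOMOGENEOUS IN ITS TABLE** (unconditional). -/
theorem lin4_smul (c : ℝ) (K : MKer (d + 1) (Fib d)) (N : ℕ) (r : ℝ)
    (T : Fin (d + 1) → (Fin (d + 1) → ℤ) → Fin (d + 1) → (Fin (d + 1) → ℤ) → MKer (d + 1) (Fib d)) :
    lin4 c K N (r • T) = r • lin4 c K N T := by
  funext κ u κ' u'
  simp only [Pi.smul_apply]
  rw [lin4_apply, lin4_apply, vsym_smul, KernelReflection.comp_smul_right, KernelReflection.comp_smul_left, mmRead_smul,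
    smul_comm c r, smul_neg]

/-- [folklore] `lin4 c K N T = (−c) •` THE BARE SANDWICH `mmRead N (K ∘ vsym K N T ∘ K)`. -/
theorem lin4_eq_smul_sandwich (c : ℝ) (K : MKer (d + 1) (Fib d)) (N : ℕ)
    (T : Fin (d + 1) → (Fin (d + 1) → ℤ) → Fin (d + 1) → (Fin (d + 1) → ℤ) → MKer (d + 1) (Fib d)) :
    lin4 c K N T = (-c) • fun κ u κ' u' => mmRead N (comp (comp K (vsym K N T κ u κ' u')) K) := by
  funext κ u κ' u'
  simp only [Pi.smul_apply]
  rw [lin4_apply, neg_smul]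

/-- [folklore] The bare sandwich is homogeneous in its table (unconditional). -/
theorem sandwich_smul (K : MKer (d + 1) (Fib d)) (N : ℕ) (r : ℝ)
    (T : Fin (d + 1) → (Fin (d + 1) → ℤ) → Fin (d + 1) → (Fin (d + 1) → ℤ) → MKer (d + 1) (Fib d)) :
    (fun κ u κ' u' => mmRead N (comp (comp K (vsym K N (r • T) κ u κ' u')) K)) =
      r • fun κ u κ' u' => mmRead N (comp (comp K (vsym K N T κ u κ' u')) K) := by
  funext κ u κ' u'
  simp only [Pi.smul_apply]
  rw [vsym_smul, KernelReflection.comp_smul_right, KernelReflection.comp_smul_left, mmRead_smul]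

/-- [folklore] **THE POWERS OF THE SCALAR COME OUT OF THE COMPOSITE TRANSPORT** (SKELETON-W3 (R12-3)): for any family of packed kernels
`K j`, the `k`-fold transport of the maps `lin4 c (K j) N` from level `m` is `(−c)^k •` the `k`-fold transport of the bare sandwiches
`X ↦ mmRead N (K j ∘ vsym (K j) N X ∘ K j)` — for an2's objects `c = cE₂·Lc^{2(d+1)}`: no power of `cE₂` is hidden in a constant. -/
theorem transport_lin4_eq_pow_smul (c : ℝ) (K : ℕ → MKer (d + 1) (Fib d)) (N m k : ℕ)
    (X : Fin (d + 1) → (Fin (d + 1) → ℤ) → Fin (d + 1) → (Fin (d + 1) → ℤ) → MKer (d + 1) (Fib d)) :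
    transport (fun j => lin4 c (K j) N) m k X =
      (-c) ^ k • transport (fun j Y => fun κ u κ' u' => mmRead N (comp (comp (K j) (vsym (K j) N Y κ u κ' u')) (K j))) m k X := by
  have hfun : (fun j => lin4 c (K j) N) =
      fun j Y => (-c) • (fun κ u κ' u' => mmRead N (comp (comp (K j) (vsym (K j) N Y κ u κ' u')) (K j))) := by
    funext j Y
    exact lin4_eq_smul_sandwich c (K j) N Y
  rw [hfun]
  exact transport_smul_eq (P := fun _ => True) (fun _ _ _ => trivial) (fun j r Y _ => sandwich_smul (K j) N r Y) (-c) m k trivial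

end Summit.QuantumFields.BalabanUV.Beta.GAN24.Lin4Additive

end
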